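import Literature.Probability.LatticeModels.RotatedTorus
import Literature.Probability.LatticeModels.TorusTransferSpectral
import HarnessLib

/-!
# The diagonal transfer matrix of the rotated torus: even layers, two-step positivity, traces

Topic `Literature/Probability/LatticeModels`; family `crit-ising`. No named fact, no sorry.

Aizenman–Duminil-Copin 2021, proof of Prop. 5.4 (iii) (arXiv:1912.07973 p. 18): "The natural
transfer matrix in this direction … is defined by adding two [layers] at a time — alternatively a
layer of odd vertices only and then a layer of even vertices only. We deduce that `S(x)` restricted to
vertices `x` with `x₁ + x₂` even, can be expressed using two transfer matrices `T` and `T*` … and when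
restricting to even values of `x₁ + x₂` we end up with the matrix `TT*`, which is positive."

This file carries this out on the rotated torus `RotSite d'' N = ℤ/2Nℤ × (ℤ/Nℤ)^{d''+1}` of
`RotatedTorus` (coordinates `(a, w) = (x₀+x₁, (x₁, x₂, …))`):

* Part A: the parity decomposition `a = 2m + ε` (`parityEquiv`, `twoMul`);
* Part B: the edges of `rotGraph`, each counted once (`sum_edgeFinset_rotGraph`, `N ≥ 3`);
* Part C: the even / odd diagonal layers pulled back by the diagonal translation `τ^m`,
  `R_m(w) = σ(2m, w + m e_b)`, `S_m(w) = σ(2m+1, w + m e_b)` (`evenLayer`, `oddLayer`,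
  `rotLayersEquiv`), and the energy along the diagonal,
  `-H = ∑_m [E(R_m) + E(S_m) + C(R_m,S_m) + C(R_{m+1},S_m)]` (`neg_isingHamiltonian_rot_eq`) with the
  *same* coupling form `C(R,S) = ∑_w R(w)(S(w) + S(w+e_b))` on both sides of an odd layer;
* Part D: the two-step matrix `M = K D_odd Kᵀ` and its symmetrisation `A = D^{1/2} M D^{1/2}`, both
  **positive semidefinite** (`twoStepMatrix_posSemidef`, `diagTransfer_posSemidef`) — no reflection
  positivity is used, only `K D Kᵀ ≥ 0`;
* Part E: `∑_σ e^{-βH} f(R₀) g(R_n) = Tr(diag f Aⁿ diag g A^{N-n})` (`sum_exp_mul_evenLayerObs_eq_trace`).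

The spectral consequences (monotonicity of the diagonal Fourier modes, ADC Prop. 5.4 (iii) on the
rotated torus and in infinite volume) are drawn in the sequel. Step V4b of the tree's programme
towards ADC Thm 5.6 (`aizenmanDuminilCopin_slidingScaleInfraredBound`).

## References

* M. Aizenman, H. Duminil-Copin, Ann. of Math. 194 (2021) = arXiv:1912.07973, proof of Prop. 5.4
  (p. 18) [AizenmanDuminilCopinAnnals2021].
* T. D. Schultz, D. C. Mattis, E. H. Lieb, Rev. Mod. Phys. 36 (1964), §II [SchultzMattisLieb1964].

## Mathlib

`Matrix.PosSemidef.mul_mul_conjTranspose_same`, `Matrix.posSemidef_diagonal_iff`,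
`Finset.prod_univ_sum`, `Equiv.sum_comp`; the tree's `sum_mul_mul_prod_cyclic_eq_trace`.
-/

noncomputable section

open MeasureTheory Filter Topology Finset Matrix

namespace Literature.Probability.LatticeModels

/-! ### Part A. Parity decomposition of `ℤ/2Nℤ` -/

section Parity

variable {N : ℕ} [NeZero N]

/-- `2m ∈ ℤ/2Nℤ` for `m ∈ ℤ/Nℤ` (the even diagonal layers `a = x₀ + x₁ = 2m`). [folklore] -/
def twoMul (m : ZMod N) : ZMod (2 * N) := ((2 * m.val : ℕ) : ZMod (2 * N))

/-- The parity decomposition `ℤ/2Nℤ ≃ ℤ/Nℤ × {0,1}`, `a = 2m + ε`. [folklore] -/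
def parityEquiv : ZMod (2 * N) ≃ ZMod N × Fin 2 where
  toFun a := (((a.val / 2 : ℕ) : ZMod N), ⟨a.val % 2, Nat.mod_lt _ (by norm_num)⟩)
  invFun p := ((2 * p.1.val + p.2.val : ℕ) : ZMod (2 * N))
  left_inv a := by
    have ha := ZMod.val_lt a
    have h1 : (a.val / 2) % N = a.val / 2 := Nat.mod_eq_of_lt (by omega)
    simp only [ZMod.val_natCast, h1]
    have : 2 * (a.val / 2) + a.val % 2 = a.val := by omega
    rw [this, ZMod.natCast_zmod_val]
  right_inv p := by
    obtain ⟨m, ε⟩ := p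
    have hm := ZMod.val_lt m
    have hε := ε.isLt
    have hlt : 2 * m.val + ε.val < 2 * N := by omega
    simp only [ZMod.val_natCast, Nat.mod_eq_of_lt hlt]
    have h1 : (2 * m.val + ε.val) / 2 = m.val := by omega
    have h2 : (2 * m.val + ε.val) % 2 = ε.val := by omega
    ext
    · simp only [h1, ZMod.natCast_zmod_val]
    · simp only [h2]

/-- The inverse parity map. [folklore] -/
theorem parityEquiv_symm_apply (m : ZMod N) (ε : Fin 2) :
    parityEquiv.symm (m, ε) = ((2 * m.val + ε.val : ℕ) : ZMod (2 * N)) := rfl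

/-- `2m + 0`: the even layer. [folklore] -/
theorem parityEquiv_symm_zero (m : ZMod N) : parityEquiv.symm (m, 0) = twoMul m := by
  rw [parityEquiv_symm_apply, twoMul]; simp

/-- `2m + 1`: the odd layer. [folklore] -/
theorem parityEquiv_symm_one (m : ZMod N) : parityEquiv.symm (m, 1) = twoMul m + 1 := by
  rw [parityEquiv_symm_apply, twoMul, Fin.val_one]
  push_cast
  ring

omit [NeZero N] in
/-- `2·` commutes with reduction: `(2a) mod 2N = 2 (a mod N)`. [folklore] -/
theorem two_mul_mod_two_mul (a : ℕ) : (2 * a) % (2 * N) = 2 * (a % N) := Nat.mul_mod_mul_left 2 a N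

/-- `(2m + 1) + 1 = 2(m + 1)` in `ℤ/2Nℤ`. [folklore] -/
theorem twoMul_add_one_add_one (m : ZMod N) : twoMul m + 1 + 1 = twoMul (m + 1) := by
  unfold twoMul
  have hval : (m + 1).val = (m.val + 1) % N := by
    rw [ZMod.val_add, ZMod.val_one_eq_one_mod, Nat.add_mod_mod]
  rw [hval, add_assoc, show ((2 * m.val : ℕ) : ZMod (2 * N)) + (1 + 1) = ((2 * (m.val + 1) : ℕ) : ZMod (2 * N)) by
    push_cast; ring, ZMod.natCast_eq_natCast_iff', two_mul_mod_two_mul, two_mul_mod_two_mul, Nat.mod_mod]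

/-- `twoMul` is additive. [folklore] -/
theorem twoMul_add (m m' : ZMod N) : twoMul (m + m') = twoMul m + twoMul m' := by
  unfold twoMul
  rw [ZMod.val_add, ← Nat.cast_add, ZMod.natCast_eq_natCast_iff', ← mul_add, two_mul_mod_two_mul,
    two_mul_mod_two_mul, Nat.mod_mod]

omit [NeZero N] in
/-- `2·0 = 0`. [folklore] -/
@[simp] theorem twoMul_zero : twoMul (0 : ZMod N) = 0 := by simp [twoMul]

end Parity

/-! ### Part B. Edges of the rotated torus, each counted once -/

section Edges

variable {d'' : ℕ} {N : ℕ}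

/-- The jumps `π(eᵢ)` of the rotated torus: `π(e₀) = (1, 0)`, `π(e₁) = (1, e_b)`, `π(e_{j+2}) = (0, e_{z_j})`
with `e_b = single 0 1` and `e_{z_j} = single (j+1) 1` in the layer `(ℤ/Nℤ)^{d''+1}`. [folklore] -/
theorem rotProj_single_zero : rotProj d'' N (Pi.single 0 1) = ((1 : ZMod (2 * N)), (0 : TorusSite (d'' + 1) N)) := by
  ext j
  · rw [rotProj_apply_fst]; simp
  · rw [rotProj_apply_snd]; simp [Fin.succ_ne_zero]

/-- `π(e₁) = (1, e_b)`. [folklore] -/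
theorem rotProj_single_one : rotProj d'' N (Pi.single 1 1) = ((1 : ZMod (2 * N)), (Pi.single 0 1 : TorusSite (d'' + 1) N)) := by
  ext j
  · rw [rotProj_apply_fst]; simp
  · rw [rotProj_apply_snd]
    by_cases hj : j = 0
    · subst hj; simp
    · have : (j.succ : Fin (d'' + 2)) ≠ 1 := fun h => hj (Fin.succ_injective _ (by rw [h]; rfl))
      simp [Pi.single_eq_of_ne this, Pi.single_eq_of_ne hj]

/-- `π(e_{j+2}) = (0, e_{z_j})`. [folklore] -/
theorem rotProj_single_succ_succ (j : Fin d'') :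
    rotProj d'' N (Pi.single j.succ.succ 1) = ((0 : ZMod (2 * N)), (Pi.single j.succ 1 : TorusSite (d'' + 1) N)) := by
  ext l
  · rw [rotProj_apply_fst]
    simp [Pi.single_eq_of_ne (show (1 : Fin (d'' + 2)) ≠ j.succ.succ from fun h => Fin.succ_ne_zero j (Fin.succ_injective _ h.symm))]
  · rw [rotProj_apply_snd]
    by_cases hl : l = j.succ
    · subst hl; simp
    · have : (l.succ : Fin (d'' + 2)) ≠ j.succ.succ := fun h => hl (Fin.succ_injective _ h)
      simp [Pi.single_eq_of_ne this, Pi.single_eq_of_ne hl]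

/-- For `N ≥ 3` no jump is the negative of a jump: `π(eᵢ) ≠ -π(e_{i'})`. [folklore] -/
theorem rotProj_single_ne_neg (hN : 3 ≤ N) (i i' : Fin (d'' + 2)) :
    rotProj d'' N (Pi.single i 1) ≠ -rotProj d'' N (Pi.single i' 1) := by
  intro h
  have h2 : rotProj d'' N (Pi.single i 1 + Pi.single i' 1) = 0 := by rw [map_add, h, neg_add_cancel]
  have := (rotProj_eq_zero_iff_of_abs_lt (N := N) (v := Pi.single i 1 + Pi.single i' 1) fun j => ?_).1 h2
  · have := congrFun this i
    simp only [Pi.add_apply, Pi.single_eq_same, Pi.zero_apply] at this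
    rcases eq_or_ne i i' with rfl | hii'
    · simp at this
    · rw [Pi.single_eq_of_ne hii'] at this; simp at this
  · rw [Pi.add_apply]
    have h1 : |(Pi.single i (1 : ℤ) : Site (d'' + 2)) j| ≤ 1 := by
      rcases eq_or_ne j i with rfl | hj
      · simp
      · simp [Pi.single_eq_of_ne hj]
    have h1' : |(Pi.single i' (1 : ℤ) : Site (d'' + 2)) j| ≤ 1 := by
      rcases eq_or_ne j i' with rfl | hj
      · simp
      · simp [Pi.single_eq_of_ne hj]
    have : (3 : ℤ) ≤ N := by exact_mod_cast hN
    calc |(Pi.single i (1 : ℤ) : Site (d'' + 2)) j + (Pi.single i' (1 : ℤ) : Site (d'' + 2)) j|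
        ≤ |(Pi.single i (1 : ℤ) : Site (d'' + 2)) j| + |(Pi.single i' (1 : ℤ) : Site (d'' + 2)) j| := abs_add_le _ _
      _ < N := by linarith

/-- The jumps are pairwise distinct. [folklore] -/
theorem rotProj_single_injective (hN : 3 ≤ N) : Function.Injective fun i : Fin (d'' + 2) => rotProj d'' N (Pi.single i 1) := by
  intro i i' h
  simp only at h
  have h2 : rotProj d'' N (Pi.single i 1 - Pi.single i' 1) = 0 := by rw [map_sub, h, sub_self]
  have := (rotProj_eq_zero_iff_of_abs_lt (N := N) (v := Pi.single i 1 - Pi.single i' 1) fun j => ?_).1 h2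
  · by_contra hii'
    have := congrFun this i
    simp only [Pi.sub_apply, Pi.single_eq_same, Pi.zero_apply, Pi.single_eq_of_ne hii'] at this
    simp at this
  · rw [Pi.sub_apply]
    have h1 : |(Pi.single i (1 : ℤ) : Site (d'' + 2)) j| ≤ 1 := by
      rcases eq_or_ne j i with rfl | hj
      · simp
      · simp [Pi.single_eq_of_ne hj]
    have h1' : |(Pi.single i' (1 : ℤ) : Site (d'' + 2)) j| ≤ 1 := by
      rcases eq_or_ne j i' with rfl | hj
      · simp
      · simp [Pi.single_eq_of_ne hj]
    have : (3 : ℤ) ≤ N := by exact_mod_cast hN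
    calc |(Pi.single i (1 : ℤ) : Site (d'' + 2)) j - (Pi.single i' (1 : ℤ) : Site (d'' + 2)) j|
        ≤ |(Pi.single i (1 : ℤ) : Site (d'' + 2)) j| + |(Pi.single i' (1 : ℤ) : Site (d'' + 2)) j| := abs_sub _ _
      _ < N := by linarith

/-- **The edges of the rotated torus, each counted once**: for `N ≥ 3`,
`∑_{e ∈ E} F(e) = ∑_u ∑ᵢ F({u, u + π(eᵢ)})`. [folklore] -/
theorem sum_edgeFinset_rotGraph [NeZero N] (hN : 3 ≤ N) {M : Type*} [AddCommMonoid M] (F : Sym2 (RotSite d'' N) → M) :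
    ∑ e ∈ (rotGraph d'' N).edgeFinset, F e = ∑ u : RotSite d'' N, ∑ i : Fin (d'' + 2), F s(u, u + rotProj d'' N (Pi.single i 1)) := by
  classical
  set J : Fin (d'' + 2) → RotSite d'' N := fun i => rotProj d'' N (Pi.single i 1) with hJ
  have hJ0 : ∀ i, J i ≠ 0 := fun i h => by
    have := rotProj_single_ne_neg (d'' := d'') hN i i
    rw [show rotProj d'' N (Pi.single i 1) = J i from rfl, h, neg_zero] at this
    exact this rfl
  set φ : RotSite d'' N × Fin (d'' + 2) → Sym2 (RotSite d'' N) := fun p => s(p.1, p.1 + J p.2) with hφ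
  have hinj : Set.InjOn φ (Finset.univ : Finset (RotSite d'' N × Fin (d'' + 2))) := by
    rintro ⟨u, i⟩ - ⟨v, i'⟩ - h
    simp only [hφ, Sym2.eq_iff] at h
    rcases h with ⟨rfl, h2⟩ | ⟨h1, h2⟩
    · exact Prod.ext rfl (rotProj_single_injective hN (add_left_cancel h2))
    · exfalso
      rw [h1, add_assoc, add_eq_left] at h2
      exact rotProj_single_ne_neg hN i' i (eq_neg_of_add_eq_zero_left h2)
  have hmaps : ∀ p ∈ (Finset.univ : Finset (RotSite d'' N × Fin (d'' + 2))), φ p ∈ (rotGraph d'' N).edgeFinset := by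
    rintro ⟨u, i⟩ -
    rw [SimpleGraph.mem_edgeFinset, hφ, SimpleGraph.mem_edgeSet, rotGraph_adj_iff]
    exact ⟨fun h => hJ0 i (by simpa using h.symm), Or.inl ⟨i, rfl⟩⟩
  have hsurj : ∀ e ∈ (rotGraph d'' N).edgeFinset, ∃ p ∈ (Finset.univ : Finset (RotSite d'' N × Fin (d'' + 2))), φ p = e := by
    intro e he
    induction e using Sym2.ind with
    | _ u v =>
      rw [SimpleGraph.mem_edgeFinset, SimpleGraph.mem_edgeSet, rotGraph_adj_iff] at he
      rcases he.2 with ⟨i, hi⟩ | ⟨i, hi⟩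
      · exact ⟨(u, i), Finset.mem_univ _, by rw [hφ, hi]⟩
      · refine ⟨(v, i), Finset.mem_univ _, ?_⟩
        show s(v, v + J i) = s(u, v)
        rw [show v + J i = u from hi.symm, Sym2.eq_swap]
  have himg : Finset.univ.image φ = (rotGraph d'' N).edgeFinset := by
    ext e
    simp only [Finset.mem_image, Finset.mem_univ, true_and]
    constructor
    · rintro ⟨p, rfl⟩; exact hmaps p (Finset.mem_univ _)
    · intro he
      obtain ⟨p, -, hp⟩ := hsurj e he
      exact ⟨p, hp⟩
  rw [← himg, Finset.sum_image hinj, Fintype.sum_prod_type]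

end Edges

/-! ### Part C. Even and odd diagonal layers; the energy along the diagonal -/

section Layers

variable {d'' : ℕ} {N : ℕ} [NeZero N]

/-- The in-layer shift `s_m = m·e_b` attached to the `m`-th pair of diagonal layers (the pull-back by
the translation `τ^m`, `τ = e₀ + e₁ ↦ (2, e_b)`). [folklore] -/
def layerShift (m : ZMod N) : TorusSite (d'' + 1) N := Pi.single 0 m

omit [NeZero N] in
/-- `s_{m+m'} = s_m + s_{m'}`. [folklore] -/
theorem layerShift_add (m m' : ZMod N) : (layerShift (m + m') : TorusSite (d'' + 1) N) = layerShift m + layerShift m' := by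
  unfold layerShift; rw [Pi.single_add]

omit [NeZero N] in
/-- `s_0 = 0`. [folklore] -/
@[simp] theorem layerShift_zero : (layerShift (0 : ZMod N) : TorusSite (d'' + 1) N) = 0 := by
  unfold layerShift; simp

omit [NeZero N] in
/-- `s_1 = e_b`. [folklore] -/
theorem layerShift_one : (layerShift (1 : ZMod N) : TorusSite (d'' + 1) N) = Pi.single 0 1 := rfl

/-- The `m`-th **even diagonal layer** of a configuration, pulled back: `R_m(w) = σ(2m, w + s_m)`. [cite: AizenmanDuminilCopinAnnals2021, arXiv:1912.07973 proof of Prop. 5.4 (iii) (even vertices, p. 18)] -/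
def evenLayer (σ : SpinConfig (RotSite d'' N)) (m : ZMod N) : Layer (d'' + 1) N :=
  fun w => σ (twoMul m, w + layerShift m)

/-- The `m`-th **odd diagonal layer**, pulled back: `S_m(w) = σ(2m+1, w + s_m)`. [cite: AizenmanDuminilCopinAnnals2021, arXiv:1912.07973 proof of Prop. 5.4 (iii) (odd vertices, p. 18)] -/
def oddLayer (σ : SpinConfig (RotSite d'' N)) (m : ZMod N) : Layer (d'' + 1) N :=
  fun w => σ (twoMul m + 1, w + layerShift m)

/-- Rebuilding a configuration from its even and odd layers. [folklore] -/
def ofLayers (RS : (ZMod N → Layer (d'' + 1) N) × (ZMod N → Layer (d'' + 1) N)) : SpinConfig (RotSite d'' N) :=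
  fun u => if (parityEquiv u.1).2 = 0 then RS.1 (parityEquiv u.1).1 (u.2 - layerShift (parityEquiv u.1).1)
    else RS.2 (parityEquiv u.1).1 (u.2 - layerShift (parityEquiv u.1).1)

/-- The parity data of an even layer index. [folklore] -/
theorem parityEquiv_twoMul (m : ZMod N) : parityEquiv (twoMul m) = (m, 0) := by
  rw [← parityEquiv_symm_zero, Equiv.apply_symm_apply]

/-- The parity data of an odd layer index. [folklore] -/
theorem parityEquiv_twoMul_add_one (m : ZMod N) : parityEquiv (twoMul m + 1) = (m, 1) := by
  rw [← parityEquiv_symm_one, Equiv.apply_symm_apply]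

/-- **Configurations of the rotated torus as pairs of layer sequences** (even and odd diagonal layers,
indexed by `m ∈ ℤ/Nℤ`). [folklore] -/
def rotLayersEquiv : SpinConfig (RotSite d'' N) ≃ (ZMod N → Layer (d'' + 1) N) × (ZMod N → Layer (d'' + 1) N) where
  toFun σ := (evenLayer σ, oddLayer σ)
  invFun := ofLayers
  left_inv σ := by
    funext u
    obtain ⟨a, w⟩ := u
    unfold ofLayers
    simp only
    set q := parityEquiv a with hq
    have ha : a = parityEquiv.symm q := by rw [hq, Equiv.symm_apply_apply]
    obtain ⟨m, ε⟩ := q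
    rw [ha]
    fin_cases ε
    · simp only [evenLayer, sub_add_cancel]
      rfl
    · simp only [Fin.mk_one, parityEquiv_symm_one, oddLayer, sub_add_cancel]
      simp
  right_inv RS := by
    obtain ⟨R, S⟩ := RS
    ext m w
    · simp only [evenLayer, ofLayers, parityEquiv_twoMul, if_true, add_sub_cancel_right]
    · simp only [oddLayer, ofLayers, parityEquiv_twoMul_add_one, add_sub_cancel_right]
      simp

/-- First component: the even layers. [folklore] -/
@[simp] theorem rotLayersEquiv_apply_fst (σ : SpinConfig (RotSite d'' N)) : (rotLayersEquiv σ).1 = evenLayer σ := rfl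
/-- Second component: the odd layers. [folklore] -/
@[simp] theorem rotLayersEquiv_apply_snd (σ : SpinConfig (RotSite d'' N)) : (rotLayersEquiv σ).2 = oddLayer σ := rfl

/-- The even layers of a rebuilt configuration. [folklore] -/
theorem evenLayer_symm (RS : (ZMod N → Layer (d'' + 1) N) × (ZMod N → Layer (d'' + 1) N)) :
    evenLayer (rotLayersEquiv.symm RS) = RS.1 := congrArg Prod.fst (rotLayersEquiv.apply_symm_apply RS)

/-- The odd layers of a rebuilt configuration. [folklore] -/
theorem oddLayer_symm (RS : (ZMod N → Layer (d'' + 1) N) × (ZMod N → Layer (d'' + 1) N)) :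
    oddLayer (rotLayersEquiv.symm RS) = RS.2 := congrArg Prod.snd (rotLayersEquiv.apply_symm_apply RS)

/-- **Sums over the rotated torus by layer pairs**: `∑_u F(u) = ∑_m ∑_w [F(2m, w + s_m) + F(2m+1, w + s_m)]`. [folklore] -/
theorem sum_rotSite_eq {M : Type*} [AddCommMonoid M] (F : RotSite d'' N → M) :
    ∑ u, F u = ∑ m : ZMod N, ∑ w : TorusSite (d'' + 1) N,
      (F (twoMul m, w + layerShift m) + F (twoMul m + 1, w + layerShift m)) := by
  rw [Fintype.sum_prod_type, ← Equiv.sum_comp parityEquiv.symm, Fintype.sum_prod_type]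
  refine Finset.sum_congr rfl fun m _ => ?_
  rw [Fin.sum_univ_two, parityEquiv_symm_zero, parityEquiv_symm_one, ← Finset.sum_add_distrib]
  exact (Fintype.sum_equiv (Equiv.addRight (layerShift m)) _ _ fun w => rfl).symm

/-- The **intra-layer energy** of a diagonal layer: the bonds in the directions `e₂, …, e_{d''+1}`
(none for `d'' = 0`), counted once, plus the field. [cite: AizenmanDuminilCopinAnnals2021, arXiv:1912.07973 proof of Prop. 5.4 (iii) (p. 18)] -/
def diagLayerEnergy (h : ℝ) (L : Layer (d'' + 1) N) : ℝ :=
  (∑ w, ∑ j : Fin d'', spinAt w L * spinAt (w + Pi.single j.succ 1) L) + h * ∑ w, spinAt w L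

/-- The **coupling of an even layer `R` to an odd layer `S`**: `C(R, S) = ∑_w R(w)(S(w) + S(w + e_b))`
(the bonds `e₀` and `e₁` between consecutive diagonal layers, in pulled-back coordinates; the same form
for the pair `(2m, 2m+1)` and for the pair `(2m+2, 2m+1)`). [cite: AizenmanDuminilCopinAnnals2021, arXiv:1912.07973 proof of Prop. 5.4 (iii) (p. 18)] -/
def diagCoupling (R S : Layer (d'' + 1) N) : ℝ := ∑ w, spinAt w R * (spinAt w S + spinAt (w + Pi.single 0 1) S)

omit [NeZero N] in
/-- `σ_{(2m, w + s_m)} = R_m(w)`. [folklore] -/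
theorem spinAt_even (σ : SpinConfig (RotSite d'' N)) (m : ZMod N) (w : TorusSite (d'' + 1) N) :
    spinAt (twoMul m, w + layerShift m) σ = spinAt w (evenLayer σ m) := rfl

omit [NeZero N] in
/-- `σ_{(2m+1, w + s_m)} = S_m(w)`. [folklore] -/
theorem spinAt_odd (σ : SpinConfig (RotSite d'' N)) (m : ZMod N) (w : TorusSite (d'' + 1) N) :
    spinAt (twoMul m + 1, w + layerShift m) σ = spinAt w (oddLayer σ m) := rfl

/-- **The energy of the rotated torus along the diagonal** (Aizenman–Duminil-Copin 2021, proof of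
Prop. 5.4 (iii): the transfer in the direction `e₀ + e₁`, adding alternately a layer of even and of
odd vertices): for `N ≥ 3`,
`-H(σ) = ∑_m [E(R_m) + E(S_m) + C(R_m, S_m) + C(R_{m+1}, S_m)]`. [cite: AizenmanDuminilCopinAnnals2021, arXiv:1912.07973 proof of Prop. 5.4 (iii) (p. 18)] -/
theorem neg_isingHamiltonian_rot_eq (hN : 3 ≤ N) (h : ℝ) (σ : SpinConfig (RotSite d'' N)) :
    -isingHamiltonian (rotGraph d'' N) Finset.univ h .free σ =
      ∑ m : ZMod N, (diagLayerEnergy h (evenLayer σ m) + diagLayerEnergy h (oddLayer σ m) +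
        diagCoupling (evenLayer σ m) (oddLayer σ m) + diagCoupling (evenLayer σ (m + 1)) (oddLayer σ m)) := by
  simp only [isingHamiltonian, interactionEdges_free, edgesIn_univ_eq, neg_sub, sub_neg_eq_add,
    sum_edgeFinset_rotGraph hN, bondSpin_mk]
  simp only [sum_rotSite_eq]
  simp only [Fin.sum_univ_succ (n := d'' + 1), Fin.sum_univ_succ (n := d''), rotProj_single_zero,
    rotProj_single_one, Fin.succ_zero_eq_one, rotProj_single_succ_succ, Prod.mk_add_mk, add_zero]
  -- identify each site with a layer value
  have e1 : ∀ m (w : TorusSite (d'' + 1) N), spinAt (twoMul m + 1, w + layerShift m + Pi.single 0 1) σ =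
      spinAt (w + Pi.single 0 1) (oddLayer σ m) := fun m w => by
    rw [← spinAt_odd, add_right_comm]
  have e2 : ∀ m (w : TorusSite (d'' + 1) N) (j : Fin d''), spinAt (twoMul m, w + layerShift m + Pi.single j.succ 1) σ =
      spinAt (w + Pi.single j.succ 1) (evenLayer σ m) := fun m w j => by
    rw [← spinAt_even, add_right_comm]
  have e3 : ∀ m (w : TorusSite (d'' + 1) N), spinAt (twoMul m + 1 + 1, w + layerShift m) σ =
      spinAt (w - Pi.single 0 1) (evenLayer σ (m + 1)) := fun m w => by
    rw [← spinAt_even, twoMul_add_one_add_one, layerShift_add, layerShift_one, sub_add_add_cancel]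
  have e4 : ∀ m (w : TorusSite (d'' + 1) N), spinAt (twoMul m + 1 + 1, w + layerShift m + Pi.single 0 1) σ =
      spinAt w (evenLayer σ (m + 1)) := fun m w => by
    rw [← spinAt_even, twoMul_add_one_add_one, layerShift_add, layerShift_one, add_assoc]
  have e5 : ∀ m (w : TorusSite (d'' + 1) N) (j : Fin d''), spinAt (twoMul m + 1, w + layerShift m + Pi.single j.succ 1) σ =
      spinAt (w + Pi.single j.succ 1) (oddLayer σ m) := fun m w j => by
    rw [← spinAt_odd, add_right_comm]
  simp only [spinAt_even, spinAt_odd, e1, e2, e3, e4, e5]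
  -- the odd→even coupling: reindex `w ↦ w + e_b` in the `e₀` bond
  have e6 : ∀ m, ∑ w : TorusSite (d'' + 1) N, spinAt w (oddLayer σ m) * spinAt (w - Pi.single 0 1) (evenLayer σ (m + 1)) =
      ∑ w : TorusSite (d'' + 1) N, spinAt (w + Pi.single 0 1) (oddLayer σ m) * spinAt w (evenLayer σ (m + 1)) := fun m =>
    (Fintype.sum_equiv (Equiv.addRight (Pi.single 0 1)) _ _ fun w => by simp).symm
  have e7 : ∀ (m m' : ZMod N) (w w' : TorusSite (d'' + 1) N),
      spinAt w (oddLayer σ m) * spinAt w' (evenLayer σ m') = spinAt w' (evenLayer σ m') * spinAt w (oddLayer σ m) :=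
    fun _ _ _ _ => mul_comm _ _
  simp only [diagLayerEnergy, diagCoupling, Finset.sum_add_distrib, Finset.mul_sum, mul_add, e6]
  simp only [e7]
  ring

end Layers

/-! ### Part D. The two-step transfer matrix and its positivity -/

section TransferMatrix

variable {d'' : ℕ} {N : ℕ} [NeZero N]

/-- The Boltzmann factor of a diagonal layer, `e^{βE_h(L)}`. [folklore] -/
def diagWeight (β h : ℝ) (L : Layer (d'' + 1) N) : ℝ := Real.exp (β * diagLayerEnergy h L)

/-- Its square root, `e^{βE_h(L)/2}`. [folklore] -/
def diagHalfWeight (β h : ℝ) (L : Layer (d'' + 1) N) : ℝ := Real.exp (β * diagLayerEnergy h L / 2)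

/-- The **even–odd coupling matrix** `K(R, S) = e^{β C(R,S)}` (rows: even layers, columns: odd layers).
[cite: AizenmanDuminilCopinAnnals2021, arXiv:1912.07973 proof of Prop. 5.4 (iii) ("two transfer matrices T and T*", p. 18)] -/
def diagK (β : ℝ) : Matrix (Layer (d'' + 1) N) (Layer (d'' + 1) N) ℝ := fun R S => Real.exp (β * diagCoupling R S)

/-- The **two-step transfer matrix** between consecutive even layers, the odd layer summed out:
`M(R, R'') = ∑_S K(R,S) e^{βE_h(S)} K(R'',S)`, i.e. `M = K D_odd Kᵀ` (Aizenman–Duminil-Copin 2021,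
proof of Prop. 5.4 (iii): "the matrix `T T*`, which is positive"). [cite: AizenmanDuminilCopinAnnals2021, arXiv:1912.07973 proof of Prop. 5.4 (iii) (p. 18)] -/
def twoStepMatrix (β h : ℝ) : Matrix (Layer (d'' + 1) N) (Layer (d'' + 1) N) ℝ :=
  diagK β * diagonal (diagWeight β h) * (diagK β).transpose

/-- Entries of the two-step matrix. [folklore] -/
theorem twoStepMatrix_apply (β h : ℝ) (R R'' : Layer (d'' + 1) N) :
    twoStepMatrix β h R R'' = ∑ S, diagK β R S * diagWeight β h S * diagK β R'' S := by
  rw [twoStepMatrix, Matrix.mul_apply]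
  refine Finset.sum_congr rfl fun S _ => ?_
  rw [Matrix.mul_diagonal, Matrix.transpose_apply]

/-- The **symmetrised diagonal transfer matrix** `A = D_even^{1/2} (K D_odd Kᵀ) D_even^{1/2}`.
[cite: AizenmanDuminilCopinAnnals2021, arXiv:1912.07973 proof of Prop. 5.4 (iii) (p. 18)] -/
def diagTransfer (β h : ℝ) : Matrix (Layer (d'' + 1) N) (Layer (d'' + 1) N) ℝ :=
  diagonal (diagHalfWeight β h) * twoStepMatrix β h * diagonal (diagHalfWeight β h)

/-- Entries of the symmetrised transfer matrix. [folklore] -/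
theorem diagTransfer_apply (β h : ℝ) (R R'' : Layer (d'' + 1) N) :
    diagTransfer β h R R'' = diagHalfWeight β h R * twoStepMatrix β h R R'' * diagHalfWeight β h R'' := by
  rw [diagTransfer, Matrix.mul_diagonal, Matrix.diagonal_mul]

/-- **The two-step transfer matrix is positive semidefinite** (`K D Kᵀ` with `D ≥ 0` diagonal — the
positivity of `T T*`). [cite: AizenmanDuminilCopinAnnals2021, arXiv:1912.07973 proof of Prop. 5.4 (iii) (p. 18)] -/
theorem twoStepMatrix_posSemidef (β h : ℝ) : (twoStepMatrix (d'' := d'') (N := N) β h).PosSemidef := by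
  have hD : (diagonal (diagWeight (d'' := d'') (N := N) β h)).PosSemidef :=
    Matrix.posSemidef_diagonal_iff.2 fun L => (Real.exp_pos _).le
  have := hD.mul_mul_conjTranspose_same (diagK (d'' := d'') (N := N) β)
  rwa [Matrix.conjTranspose_eq_transpose_of_trivial] at this

/-- **The symmetrised diagonal transfer matrix is positive semidefinite.** [cite: AizenmanDuminilCopinAnnals2021, arXiv:1912.07973 proof of Prop. 5.4 (iii) (p. 18)] -/
theorem diagTransfer_posSemidef (β h : ℝ) : (diagTransfer (d'' := d'') (N := N) β h).PosSemidef := by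
  have := (twoStepMatrix_posSemidef (d'' := d'') (N := N) β h).conjTranspose_mul_mul_same (diagonal (diagHalfWeight β h))
  rwa [Matrix.diagonal_conjTranspose, show star (diagHalfWeight (d'' := d'') (N := N) β h) = diagHalfWeight β h from
    funext fun _ => star_trivial _] at this

/-- `A` is symmetric. [folklore] -/
theorem diagTransfer_transpose (β h : ℝ) : (diagTransfer (d'' := d'') (N := N) β h).transpose = diagTransfer β h := by
  have := (diagTransfer_posSemidef (d'' := d'') (N := N) β h).1
  rwa [Matrix.IsHermitian, Matrix.conjTranspose_eq_transpose_of_trivial] at this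

end TransferMatrix

/-! ### Part E. Configuration sums with even-layer observables are two-insertion traces -/

section Traces

variable {d'' : ℕ} {N : ℕ} [NeZero N]

/-- **Factorisation of the Boltzmann weight along the diagonal**: for `N ≥ 3`,
`e^{-βH(σ)} = ∏_m e^{βE(R_m)} e^{βE(S_m)} K(R_m,S_m) K(R_{m+1},S_m)`. [cite: AizenmanDuminilCopinAnnals2021, arXiv:1912.07973 proof of Prop. 5.4 (iii) (p. 18)] -/
theorem exp_neg_mul_isingHamiltonian_rot_eq (hN : 3 ≤ N) (β h : ℝ) (σ : SpinConfig (RotSite d'' N)) :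
    Real.exp (-β * isingHamiltonian (rotGraph d'' N) Finset.univ h .free σ) =
      ∏ m : ZMod N, (diagWeight β h (evenLayer σ m) * diagWeight β h (oddLayer σ m) *
        diagK β (evenLayer σ m) (oddLayer σ m) * diagK β (evenLayer σ (m + 1)) (oddLayer σ m)) := by
  rw [show -β * isingHamiltonian (rotGraph d'' N) Finset.univ h .free σ =
      β * -isingHamiltonian (rotGraph d'' N) Finset.univ h .free σ by ring, neg_isingHamiltonian_rot_eq hN h σ,
    Finset.mul_sum, Real.exp_sum]
  refine Finset.prod_congr rfl fun m _ => ?_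
  simp only [diagWeight, diagK, ← Real.exp_add]
  congr 1
  ring

/-- **Summing out the odd layers**: for a function of the even layers,
`∑_σ e^{-βH(σ)} F(R(σ)) = ∑_R F(R) ∏_m A(R_m, R_{m+1})`, `A` the symmetrised diagonal transfer matrix.
[cite: AizenmanDuminilCopinAnnals2021, arXiv:1912.07973 proof of Prop. 5.4 (iii) (p. 18)] -/
theorem sum_exp_mul_evenObs_eq (hN : 3 ≤ N) (β h : ℝ) (F : (ZMod N → Layer (d'' + 1) N) → ℝ) :
    ∑ σ : SpinConfig (RotSite d'' N), Real.exp (-β * isingHamiltonian (rotGraph d'' N) Finset.univ h .free σ) * F (evenLayer σ) =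
      ∑ R : ZMod N → Layer (d'' + 1) N, F R * ∏ m : ZMod N, diagTransfer β h (R m) (R (m + 1)) := by
  classical
  rw [← Equiv.sum_comp rotLayersEquiv.symm, Fintype.sum_prod_type]
  refine Finset.sum_congr rfl fun R _ => ?_
  simp only [exp_neg_mul_isingHamiltonian_rot_eq hN, evenLayer_symm, oddLayer_symm]
  -- `∑_S ∏_m φ_m(S_m) = ∏_m ∑_L φ_m(L)`
  have hfact : ∑ S : ZMod N → Layer (d'' + 1) N, (∏ m : ZMod N, (diagWeight β h (R m) * diagWeight β h (S m) *
      diagK β (R m) (S m) * diagK β (R (m + 1)) (S m))) * F R =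
      F R * ∏ m : ZMod N, ∑ L : Layer (d'' + 1) N, diagWeight β h (R m) * diagWeight β h L *
        diagK β (R m) L * diagK β (R (m + 1)) L := by
    rw [← Finset.sum_mul, mul_comm, Finset.prod_univ_sum]
    simp only [Fintype.piFinset_univ]
  rw [hfact]
  congr 1
  -- `∏_m e^{βE(R_m)} M(R_m,R_{m+1}) = ∏_m A(R_m, R_{m+1})` (distribute the half weights)
  have h1 : ∀ m, ∑ L : Layer (d'' + 1) N, diagWeight β h (R m) * diagWeight β h L * diagK β (R m) L * diagK β (R (m + 1)) L =
      diagWeight β h (R m) * twoStepMatrix β h (R m) (R (m + 1)) := by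
    intro m
    rw [twoStepMatrix_apply, Finset.mul_sum]
    exact Finset.sum_congr rfl fun L _ => by ring
  simp only [h1, diagTransfer_apply, Finset.prod_mul_distrib]
  have hshift : ∏ m : ZMod N, diagHalfWeight β h (R (m + 1)) = ∏ m : ZMod N, diagHalfWeight β h (R m) :=
    Fintype.prod_equiv (Equiv.addRight (1 : ZMod N)) (fun m => diagHalfWeight β h (R (m + 1)))
      (fun m => diagHalfWeight β h (R m)) (fun _ => rfl)
  have hsq : ∏ m : ZMod N, diagWeight β h (R m) =
      (∏ m : ZMod N, diagHalfWeight β h (R m)) * ∏ m : ZMod N, diagHalfWeight β h (R m) := by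
    rw [← Finset.prod_mul_distrib]
    refine Finset.prod_congr rfl fun m _ => ?_
    rw [diagWeight, diagHalfWeight, ← Real.exp_add]
    congr 1
    ring
  rw [hshift, hsq]
  ring

/-- **Cyclic sums with two insertions over `ℤ/Nℤ` are two-insertion traces** (the `ℤ/Nℤ`-indexed form
of `sum_mul_mul_prod_cyclic_eq_trace` of `TorusTransferSpectral`). [cite: SchultzMattisLieb1964, §II] -/
theorem sum_zmod_mul_mul_prod_cyclic_eq_trace {ι : Type*} [Fintype ι] [DecidableEq ι] (A : Matrix ι ι ℝ)
    (f g : ι → ℝ) (n : ZMod N) :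
    ∑ rs : ZMod N → ι, f (rs 0) * g (rs n) * ∏ m : ZMod N, A (rs m) (rs (m + 1)) =
      (diagonal f * A ^ n.val * diagonal g * A ^ (N - n.val)).trace := by
  obtain ⟨M, rfl⟩ : ∃ M, N = M + 1 := ⟨N - 1, by have := NeZero.ne N; omega⟩
  exact sum_mul_mul_prod_cyclic_eq_trace A f g M n

/-- **Configuration sums on the rotated torus with two even-layer observables are two-insertion traces
of the diagonal transfer matrix**: for `N ≥ 3`,
`∑_σ e^{-βH(σ)} f(R₀(σ)) g(R_n(σ)) = Tr(diag f · Aⁿ · diag g · A^{N-n})`. [cite: AizenmanDuminilCopinAnnals2021, arXiv:1912.07973 proof of Prop. 5.4 (iii) (p. 18)] -/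
theorem sum_exp_mul_evenLayerObs_eq_trace (hN : 3 ≤ N) (β h : ℝ) (f g : Layer (d'' + 1) N → ℝ) (n : ZMod N) :
    ∑ σ : SpinConfig (RotSite d'' N), Real.exp (-β * isingHamiltonian (rotGraph d'' N) Finset.univ h .free σ) *
        (f (evenLayer σ 0) * g (evenLayer σ n)) =
      (diagonal f * diagTransfer β h ^ n.val * diagonal g * diagTransfer β h ^ (N - n.val)).trace := by
  classical
  rw [sum_exp_mul_evenObs_eq hN β h (fun R => f (R 0) * g (R n))]
  exact sum_zmod_mul_mul_prod_cyclic_eq_trace _ f g n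

end Traces

end Literature.Probability.LatticeModels

end
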